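import Mathlib
import Summits.Ventures.PercRepro.TriangleCapLineTen
import Summits.Ventures.PercRepro.TriangleCapEqualityLocusKM

/-!
# PercRepro — THE EQUALITY LOCUS OF THE CLOSED FORM ON EVERY CELL OF THE DENSE CORNER (p3, gen 42; part 178)

Part 168 gave the equality locus of the closed form §10av for `k ≥ r + 7` (`K_{a,k−a}` minus a star of `r`
edges at one vertex); parts 171–177 describe the only other cells, the line `k = r + 6` (where `a = 3` and
`m = 2k − 3`), as the star-shaped graphs together with the hang family.  `closed_form_equality_locus_all`
puts the two together with no hypothesis beyond the cell: for `3 ≤ a` and `2a + r ≤ k`, a `K₄⁻`-free graph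
on `Fin k` with `a(k−a) − r` edges attains `2·Σ_v C(d(v),2) = (a(k−a) − r)(k−2) − r(k−1−r)` iff it is
`K_{a,k−a}` minus an `r`-star at one vertex, or `k = r + 6` and it is a hang family graph (a cubic six-core —
`K_{3,3}` or the prism — with every other vertex hung on one pair of the core).  The `(k, m)` form
`cherry_table_maximisers_all` does the same in the table's own coordinates.  Axioms: standard.
-/

namespace PercRepro

namespace TriangleCap

namespace C047

open Finset

/-- On the line the two forms of extremality agree: `2 C + 5 (k − 6) = m (k − 2)` iff `Σ d² + 5 (k − 6) = m k`. -/
theorem line_cherries_iff {k : ℕ} (D : SimpleGraph (Fin k)) [DecidableRel D.Adj] (hk : 6 ≤ k)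
    (hm : D.edgeFinset.card + 3 = 2 * k) :
    2 * cherries D + (k - 6) * (k - 1 - (k - 6)) = (3 * (k - 3) - (k - 6)) * (k - 2) ↔
      ∑ v, deg D v * deg D v + (Fintype.card (Fin k) - 6) * 5 = D.edgeFinset.card * Fintype.card (Fin k) := by
  have hsum := two_mul_cherries_add D
  have hdeg := sum_deg_eq D
  rw [Fintype.card_fin, ← hsum, hdeg]
  obtain ⟨k', hk'⟩ : ∃ k', k = k' + 6 := ⟨k - 6, by omega⟩
  subst hk'
  have hmD : D.edgeFinset.card = 2 * k' + 9 := by omega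
  have e1 : k' + 6 - 6 = k' := by omega
  have e2 : k' + 6 - 1 - k' = 5 := by omega
  have e3 : k' + 6 - 3 = k' + 3 := by omega
  have e4 : 3 * (k' + 3) - k' = 2 * k' + 9 := by omega
  have e5 : k' + 6 - 2 = k' + 4 := by omega
  rw [hmD, e1, e2, e3, e4, e5]
  constructor
  · intro h
    nlinarith [h]
  · intro h
    nlinarith [h]

/-- **THE EQUALITY LOCUS ON EVERY CELL:** for `3 ≤ a` and `2a + r ≤ k`, a `K₄⁻`-free graph on `Fin k` with
`a(k−a) − r` edges is extremal for the closed form iff it is `K_{a,k−a}` minus an `r`-star at one vertex, or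
`k = r + 6` and it is a hang family graph. -/
theorem closed_form_equality_locus_all (k a r : ℕ) (ha : 3 ≤ a) (hk : 2 * a + r ≤ k)
    (D : SimpleGraph (Fin k)) [DecidableRel D.Adj] (hK : K4mFree D)
    (hD : D.edgeFinset.card = a * (k - a) - r) :
    2 * cherries D + r * (k - 1 - r) = (a * (k - a) - r) * (k - 2) ↔
      (∃ (A : Finset (Fin k)) (v : Fin k), A.card = a ∧ BipSub D A ∧ MissingStar D A v) ∨
        (k = r + 6 ∧ HangFamily D) := by
  by_cases h7 : r + 7 ≤ k
  · rw [closed_form_equality_locus k a r ha hk h7 D hK hD]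
    constructor
    · exact Or.inl
    · rintro (h | ⟨h6, -⟩)
      · exact h
      · omega
  · have hk6 : k = r + 6 := by omega
    have ha3 : a = 3 := by omega
    subst ha3
    have hm : D.edgeFinset.card + 3 = 2 * k := by
      rw [hD]
      have : 3 * (k - 3) - r = 2 * k - 3 := by omega
      omega
    have hr : r = k - 6 := by omega
    subst hr
    rw [line_cherries_iff D (by omega) hm]
    by_cases hk7 : 7 ≤ k
    · have hline := line_eq_iff_explicit D hK (by rw [Fintype.card_fin]; exact hk7)
        (by rw [Fintype.card_fin]; exact hm)
      rw [hline]
      constructor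
      · rintro (h | h)
        · exact Or.inl h
        · exact Or.inr ⟨hk6, h⟩
      · rintro (h | ⟨-, h⟩)
        · exact Or.inl h
        · exact Or.inr h
    · -- the diagonal cell `(6, 3, 0)`: `K_{3,3}` and the prism, both hang family graphs on the whole vertex set
      have hk6' : k = 6 := by omega
      subst hk6'
      constructor
      · intro heq
        right
        refine ⟨rfl, ?_⟩
        have hE : D.edgeFinset.card = 9 := by omega
        have hsq : ∑ v, deg D v * deg D v = 54 := by
          rw [Fintype.card_fin, hE] at heq
          omega
        have hcub := cubic_of_six D (Fintype.card_fin 6) hE hsq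
        exact ⟨univ, 0, 1, by rw [card_univ, Fintype.card_fin], mem_univ _, mem_univ _, by decide,
          fun c _ => hcub c, fun w hw => absurd (mem_univ w) hw⟩
      · rintro (⟨A, v, hA, hsub, hv⟩ | ⟨-, h⟩)
        · have := closed_form_eq_of_missingStar D A hsub hv 3 0 hA (by rw [Fintype.card_fin]; omega)
            (by rw [Fintype.card_fin]; omega)
          rw [Fintype.card_fin] at this ⊢
          simpa using this
        · exact line_eq_of_hangFamily D (by rw [Fintype.card_fin]; exact hm) h

/-- **THE MAXIMISERS IN THE TABLE'S COORDINATES, EVERY CELL:** for `6 ≤ k`, `2k − 3 ≤ m ≤ k²/4` there are the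
row `a ≥ 3` and the distance `r` with `a(k−a) = m + r` the least product above `m`, and a `K₄⁻`-free graph on
`Fin k` with `m` edges attains the closed form iff it is `K_{a,k−a}` minus an `r`-star, or `k = r + 6` and it
is a hang family graph. -/
theorem cherry_table_maximisers_all (k m : ℕ) (hk : 6 ≤ k) (hm : 2 * k ≤ m + 3) (hm' : 4 * m ≤ k * k) :
    ∃ a r : ℕ, 3 ≤ a ∧ 2 * a + r ≤ k ∧ a * (k - a) = m + r ∧
      (∀ a' : ℕ, a' ≤ k → m ≤ a' * (k - a') → a * (k - a) ≤ a' * (k - a')) ∧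
      ∀ (D : SimpleGraph (Fin k)) [DecidableRel D.Adj], K4mFree D → D.edgeFinset.card = m →
        (2 * cherries D + r * (k - 1 - r) = m * (k - 2) ↔
          (∃ (A : Finset (Fin k)) (v : Fin k), A.card = a ∧ BipSub D A ∧ MissingStar D A v) ∨
            (k = r + 6 ∧ HangFamily D)) := by
  obtain ⟨a, r, ha, hk2, hprod, hleast, -⟩ := cherry_table_maximisers k m hk hm hm'
  refine ⟨a, r, ha, hk2, hprod, hleast, ?_⟩
  intro D _ hK hD
  have hD' : D.edgeFinset.card = a * (k - a) - r := by rw [hprod]; omega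
  have h := closed_form_equality_locus_all k a r ha hk2 D hK hD'
  have e : a * (k - a) - r = m := by omega
  rw [e] at h
  exact h

end C047

end TriangleCap

end PercRepro
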